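import Literature.AlgebraicGeometry.Resolution.LocalUniformizationClosedPoints
import Mathlib.Algebra.Polynomial.AlgebraMap
import Mathlib.Algebra.CharP.Defs

/-!
# `LuAlphaPTorsor`: reduction of the crux at closed-point centres to zero-dimensional valuations

Crux `Valuative.LuAlphaPTorsor` (item `stmt-ResolutionOfSingularities-0641`), line
`pfaff-line-log-final-forms`, stub G₂ `stub_zeroDimReduction`: the crux for all data whose
centre `𝔪_O ∩ A₀` is a maximal ideal of the base `A₀` AND whose valuation ring `O` is
zero-dimensional over `k` (every `x ∈ O` is a root modulo `𝔪_O` of a non-zero polynomial over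
`k`) implies the crux for all data with maximal centre.

The argument (Zariski–Samuel II, Ch. VI §17; folklore): refine `O` to a valuation ring `O' ≤ O`
containing `A₀` and minimal with this property (`exists_minimal_valuationSubring_le`); it is
zero-dimensional over `k` (`exists_aeval_mem_nonunits_of_minimal`). Since `𝔪_O ⊆ 𝔪_{O'}`, the
centre of `O'` on `A₀` contains the centre of `O`, which is maximal, so the two centres are
equal: the hypotheses "regular at the centre" and "the centre is maximal" transfer verbatim to
`O'`. The zero-dimensional crux at `O'` gives a finitely generated `A ⊆ O' ⊆ O` containing
`A₀[t]` with `Frac A = K`, regular at the centre of `O'`; regularity at the centre descends to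
the coarsening `O` (`isRegularLocalRing_centre_of_le`, Serre's theorem).
-/

set_option linter.dupNamespace false

namespace Summit.ResolutionOfSingularities.ResolutionOfSingularities.Theorems.PfaffLine

open IsLocalRing Literature.AlgebraicGeometry.Resolution

section ZeroDimReductionHelpers

variable {K : Type} [Field K]

/-- **The centre grows under refinement.** If `O' ≤ O` are valuation rings of `K` containing
the subring `B`, then the centre of `O` on `B` is contained in the centre of `O'` on `B`
(`𝔪_O ⊆ 𝔪_{O'}`). [folklore] -/
theorem zeroDimReduction_centre_le_centre {B : Subring K} {O O' : ValuationSubring K}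
    (hle : O' ≤ O) (h : B ≤ O.toSubring) (h' : B ≤ O'.toSubring) :
    Ideal.comap (Subring.inclusion h) (maximalIdeal O) ≤
      Ideal.comap (Subring.inclusion h') (maximalIdeal O') := by
  intro a ha
  have ha' : Subring.inclusion h a ∈ maximalIdeal O := ha
  have h1 : (a : K) ∈ O.nonunits := ValuationSubring.coe_mem_nonunits_iff.mpr ha'
  have h2 : (a : K) ∈ O'.nonunits := (ValuationSubring.nonunits_le_nonunits.mpr hle) h1
  change Subring.inclusion h' a ∈ maximalIdeal O'
  exact ValuationSubring.coe_mem_nonunits_iff.mp h2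

/-- Regularity of the localisation at a prime depends only on the prime as an ideal (transport
along an equality of ideals; the `IsPrime` instances are propositions). [folklore] -/
theorem zeroDimReduction_isRegularLocalRing_atPrime_of_eq {R : Type} [CommRing R]
    {I J : Ideal R} [I.IsPrime] [J.IsPrime] (hIJ : I = J)
    (hreg : IsRegularLocalRing (Localization.AtPrime I)) :
    IsRegularLocalRing (Localization.AtPrime J) := by
  subst hIJ
  exact hreg

end ZeroDimReductionHelpers

/-- **Reduction of `LuAlphaPTorsor` at closed-point centres to zero-dimensional valuations**
(stub G₂ of the line `pfaff-line-log-final-forms`): the crux for all data whose centre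
`𝔪_O ∩ A₀` is maximal and whose valuation ring `O` is zero-dimensional over `k` implies the
crux for all data with maximal centre. Refine `O` to a valuation ring `O' ≤ O` minimal over `A₀`
(`exists_minimal_valuationSubring_le`, zero-dimensional by
`exists_aeval_mem_nonunits_of_minimal`); the centre of `O'` on `A₀` contains the maximal centre
of `O`, hence equals it, so the hypotheses transfer to `O'`; the model produced at `O'` is
regular at the centre of the coarsening `O` (`isRegularLocalRing_centre_of_le`).
[cite: ZariskiSamuel1960, Ch. VI §17] [folklore] -/
theorem stub_zeroDimReduction :
    ∀ p : ℕ, p.Prime → (∀ (k K : Type) [Field k] [CharP k p] [Field K] [Algebra k K] (O : ValuationSubring K) (A₀ : Subalgebra k K) (h₀ : A₀.toSubring ≤ O.toSubring) (t : K), A₀.FG → t ^ p ∈ A₀ → IsFractionRing (Algebra.adjoin k (insert t (A₀ : Set K))) K → IsRegularLocalRing (Localization.AtPrime (Ideal.comap (Subring.inclusion h₀) (IsLocalRing.maximalIdeal O))) → (Ideal.comap (Subring.inclusion h₀) (IsLocalRing.maximalIdeal O)).IsMaximal → (∀ x : K, x ∈ O → ∃ f : Polynomial k, f ≠ 0 ∧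 Polynomial.aeval x f ∈ O.nonunits) → ∃ (A : Subalgebra k K) (h : A.toSubring ≤ O.toSubring), A₀ ≤ A ∧ t ∈ A ∧ A.FG ∧ IsFractionRing A K ∧ IsRegularLocalRing (Localization.AtPrime (Ideal.comap (Subring.inclusion h) (IsLocalRing.maximalIdeal O)))) → ∀ (k K : Type) [Field k] [CharP k p] [Field K] [Algebra k K] (O : ValuationSubring K) (A₀ : Subalgebra k K) (h₀ : A₀.toSubring ≤ O.toSubring) (t : K), A₀.FG → t ^ p ∈ A₀ → IsFractionRing (Algebra.adjoin k (insert t (A₀ : Set K))) K → IsRegularLocalRing (Localization.AtPrime (Ideal.comap (Subring.inclusion h₀) (IsLocalRing.maximalIdeal O))) → (Ideal.comap (Subring.inclusion h₀) (IsLocalRing.maximalIdeal O)).IsMaximal → ∃ (A : Subalgebra k K) (h : A.toSubring ≤ O.toSubring), A₀ ≤ A ∧ t ∈ A ∧ A.FG ∧ IsFractionRing A K ∧ IsRegularLocalRing (Localization.AtPrime (Ideal.comap (Subring.inclusion h) (IsLocalRing.maximalIdeal O))) := by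
  intro p _hp H k K _ _ _ _ O A₀ h₀ t hfg htp hfr hreg hmax
  -- a valuation ring `O' ≤ O` minimal over `A₀`: zero-dimensional over `k`
  obtain ⟨O', hO'O, h₀', hmin⟩ := exists_minimal_valuationSubring_le A₀ O h₀
  have hzd : ∀ x : K, x ∈ O' → ∃ f : Polynomial k, f ≠ 0 ∧ Polynomial.aeval x f ∈ O'.nonunits :=
    exists_aeval_mem_nonunits_of_minimal A₀ hfg O' h₀' hmin
  -- the two centres on `A₀` coincide
  have hle : Ideal.comap (Subring.inclusion h₀) (maximalIdeal O) ≤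
      Ideal.comap (Subring.inclusion h₀') (maximalIdeal O') :=
    zeroDimReduction_centre_le_centre hO'O h₀ h₀'
  have hne : Ideal.comap (Subring.inclusion h₀') (maximalIdeal O') ≠ ⊤ :=
    Ideal.IsPrime.ne_top inferInstance
  have heq : Ideal.comap (Subring.inclusion h₀) (maximalIdeal O) =
      Ideal.comap (Subring.inclusion h₀') (maximalIdeal O') :=
    hmax.eq_of_le hne hle
  have hreg' : IsRegularLocalRing (Localization.AtPrime
      (Ideal.comap (Subring.inclusion h₀') (maximalIdeal O'))) :=
    zeroDimReduction_isRegularLocalRing_atPrime_of_eq heq hreg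
  have hmax' : (Ideal.comap (Subring.inclusion h₀') (maximalIdeal O')).IsMaximal := heq ▸ hmax
  -- the zero-dimensional crux at `O'`, and descent of regularity to the coarsening `O`
  obtain ⟨A, hA, hA₀A, htA, hAfg, hfrA, hregA⟩ :=
    H k K O' A₀ h₀' t hfg htp hfr hreg' hmax' hzd
  exact ⟨A, fun x hx => hO'O (hA hx), hA₀A, htA, hAfg, hfrA,
    isRegularLocalRing_centre_of_le A hO'O hA _ hregA⟩

end Summit.ResolutionOfSingularities.ResolutionOfSingularities.Theorems.PfaffLine
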